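import Summits.FinalStateConjecture.FinalStateConjecture.Theorems.PhotonSphereChannelsChannelsResolveTameDevelopmentsRTrappedSetKappaFloor
import HarnessLib

/-!
# Crux `ChannelsResolveTameDevelopmentsR` (stmt-FinalStateConjecture-14075), line
# `trapped-set-observability-analyticity` — stub `stub_harmonicPresentation` (S3', Reshape 1),
# wave 2: the clock along horizon generators, and what the census hypothesis says

The reshaped S3 takes the horizon census `HasSphericalHorizonSections E :=
∀ c, (𝓗 ∩ {t = c}).Nonempty → Nonempty ((𝓗 ∩ {t = c}) ≃ₜ S²)` as a hypothesis.  This file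
lands the generator calculus that fixes its meaning (audit A4' of
`work/stubs/stub_harmonicPresentation_v2.md`), over the part-1 vocabulary
(`PhotonSphereChannelsTameEternalLimitDefs.lean`) and the landed chain rule along generators
(`TameEternalLimit.hasDerivAt_comp_of_isMIntegralCurve`, p102009):

* §1 **The clock IS the generator parameter**: along an integral curve `γ` of the
  clock-normalised generator field `L` starting on `𝓗` (it stays on `𝓗`, `generator_tangent`;
  `dt(L) = 1` there, `generator_null`), `t (γ s) = t (γ 0) + s` (`clock_comp_generator`).
* §2 Hence **the clock sections of a NONEMPTY horizon are ALL nonempty** (complete generators,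
  `generator_complete`, sweep every clock level: `horizon_inter_clockLevel_nonempty`), the horizon
  is empty iff SOME clock section is empty (`horizon_eq_empty_iff_exists_section_eq_empty`), and
  the census hypothesis of S3' — stated UNFOLDED, `rfl`-equal to `HasSphericalHorizonSections` of
  `PhotonSphereChannelsPresentedExteriorDefs.lean` — is the dichotomy "`𝓗 = ∅`, or EVERY clock
  section is a `2`-sphere" (`census_iff`; registered sub-goal `stub_censusAllOrNothing`): the
  census is never satisfied by a mixture of empty and spherical levels.
-/

set_option linter.dupNamespace false

noncomputable section

namespace Summit.FinalStateConjecture.FinalStateConjecture.Theorems.TrappedSet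

open Literature.Geometry.Lorentzian
open scoped Manifold ContDiff Topology
open Filter Set Function TopologicalSpace

namespace TameEternalLimit

variable (E : TameEternalLimit)

/-! ## §1 The clock along generators -/

/-- The clock of a tame eternal limit is differentiable everywhere (it is `C^∞`). [folklore] -/
theorem mdifferentiableAt_clock (p : E.Z.carrier) : MDifferentiableAt (𝓡 4) 𝓘(ℝ, ℝ) E.t p :=
  E.contMDiff_clock.mdifferentiableAt (by simp)

/-- Along an integral curve of the generator field starting on the horizon, the clock has unit
rate: `(t ∘ γ)' = dt(L) = 1`. [folklore] -/
theorem hasDerivAt_clock_comp_generator {γ : ℝ → E.Z.carrier} (hγ : IsMIntegralCurve γ E.L)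
    (h0 : γ 0 ∈ E.horizon) (s : ℝ) : HasDerivAt (E.t ∘ γ) 1 s := by
  have h := E.hasDerivAt_comp_of_isMIntegralCurve hγ s (E.mdifferentiableAt_clock (γ s))
  rwa [(E.generator_null (γ s) (E.generator_tangent γ hγ h0 s)).2.2] at h

/-- **The clock IS the generator parameter**: along an integral curve `γ` of the clock-normalised
generator field `L` with `γ 0 ∈ 𝓗`, `t (γ s) = t (γ 0) + s` for all `s`. [folklore] -/
theorem clock_comp_generator {γ : ℝ → E.Z.carrier} (hγ : IsMIntegralCurve γ E.L)
    (h0 : γ 0 ∈ E.horizon) (s : ℝ) : E.t (γ s) = E.t (γ 0) + s := by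
  have hd : ∀ r, HasDerivAt (fun r ↦ (E.t ∘ γ) r - id r) 0 r := fun r ↦
    ((E.hasDerivAt_clock_comp_generator hγ h0 r).sub (hasDerivAt_id r)).congr_deriv (sub_self 1)
  have hc := is_const_of_deriv_eq_zero (f := fun r ↦ (E.t ∘ γ) r - id r)
    (fun r ↦ (hd r).differentiableAt) (fun r ↦ (hd r).deriv) s 0
  simp only [Function.comp_apply, id_eq, sub_zero] at hc
  linarith

/-! ## §2 Clock sections of the horizon: all or nothing -/

/-- **Every clock section of a nonempty horizon is nonempty**: the complete generator through a
horizon point `p` reaches the level `t = c` at parameter `c − t p`. [folklore] -/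
theorem horizon_inter_clockLevel_nonempty (h : E.horizon.Nonempty) (c : ℝ) :
    (E.horizon ∩ {p | E.t p = c}).Nonempty := by
  obtain ⟨p, hp⟩ := h
  obtain ⟨γ, hγ, hγ0⟩ := E.generator_complete p hp
  have h0 : γ 0 ∈ E.horizon := hγ0 ▸ hp
  refine ⟨γ (c - E.t p), E.generator_tangent γ hγ h0 _, ?_⟩
  show E.t (γ (c - E.t p)) = c
  rw [E.clock_comp_generator hγ h0, hγ0]
  ring

/-- The horizon is empty iff SOME clock section of it is empty (iff all are). [folklore] -/
theorem horizon_eq_empty_iff_exists_section_eq_empty :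
    E.horizon = ∅ ↔ ∃ c : ℝ, E.horizon ∩ {p | E.t p = c} = ∅ := by
  constructor
  · intro h
    exact ⟨0, by rw [h, empty_inter]⟩
  · rintro ⟨c, hc⟩
    by_contra hne
    have h := E.horizon_inter_clockLevel_nonempty (Set.nonempty_iff_ne_empty.mpr hne) c
    rw [hc] at h
    exact Set.not_nonempty_empty h

/-- **What the census hypothesis of S3' says** (its body, `rfl`-equal to
`HasSphericalHorizonSections E`): "every NONEMPTY clock section is a `2`-sphere" is the dichotomy
"the horizon is empty, or EVERY clock section is a `2`-sphere" — no mixture of empty and spherical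
levels can occur, since a nonempty horizon meets every level. [folklore] -/
theorem census_iff :
    (∀ c : ℝ, (E.horizon ∩ {p | E.t p = c}).Nonempty →
        Nonempty ((E.horizon ∩ {p | E.t p = c} : Set E.Z.carrier) ≃ₜ Metric.sphere (0 : E3) 1)) ↔
      (E.horizon = ∅ ∨ ∀ c : ℝ,
        Nonempty ((E.horizon ∩ {p | E.t p = c} : Set E.Z.carrier) ≃ₜ Metric.sphere (0 : E3) 1)) := by
  constructor
  · intro h
    rcases Set.eq_empty_or_nonempty E.horizon with h𝓗 | h𝓗
    · exact Or.inl h𝓗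
    · exact Or.inr fun c ↦ h c (E.horizon_inter_clockLevel_nonempty h𝓗 c)
  · rintro (h𝓗 | h) c hc
    · obtain ⟨p, hp, -⟩ := hc
      rw [h𝓗] at hp
      exact hp.elim
    · exact h c

end TameEternalLimit

/-- Registered sub-goal `stub_censusAllOrNothing` of `stub_harmonicPresentation` (S3'): the clock
sections of a nonempty limit horizon are all nonempty, and the census hypothesis (unfolded) is
the dichotomy "empty horizon, or every clock section is a `2`-sphere". [folklore] -/
theorem stub_censusAllOrNothing :
    ∀ (E : TameEternalLimit), (E.horizon.Nonempty → ∀ c : ℝ, (E.horizon ∩ {p | E.t p = c}).Nonempty) ∧ ((∀ c : ℝ, (E.horizon ∩ {p | E.t p = c}).Nonempty → Nonempty ((E.horizon ∩ {p | E.t p = c} : Set E.Z.carrier) ≃ₜ Metric.sphere (0 : E3) 1)) ↔ (E.horizon = ∅ ∨ ∀ c : ℝ, Nonempty ((E.horizon ∩ {p | E.t p = c} : Set E.Z.carrier) ≃ₜ Metric.sphere (0 : E3) 1))) :=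
  fun E ↦ ⟨E.horizon_inter_clockLevel_nonempty, E.census_iff⟩

end Summit.FinalStateConjecture.FinalStateConjecture.Theorems.TrappedSet

end
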